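import Literature.Analysis.FluidPDE.OnsagerBDSV
import Literature.Analysis.FluidPDE.EulerReynoldsPressure
import Literature.Analysis.FluidPDE.TorusHeatFlow
import HarnessLib

/-!
# Proof of the BDSV time-regularity step (discharge of `BDSV.timeRegularity`)

Analysis/FluidPDE proofs file: discharges the named fact
`Literature.Analysis.FluidPDE.BDSV.timeRegularity` (`FluidPDE/OnsagerBDSV`), the time-regularity
step in the proof of Thm. 1.1 of Buckmaster–De Lellis–Székelyhidi–Vicol, *Onsager's conjecture
for admissible weak solutions*, CPAM 72 (2019) = arXiv:1701.08678, §2.2 (p. 6 of the arXiv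
version): if classical Euler–Reynolds triples `(v_q, p_q, R̊_q)` on `[0,T] × T³` converge,
`v_q → u` uniformly with `‖R̊_q‖₀ → 0`, and the slices `v_q(t)` are `β'`-Hölder uniformly in
`q, t` (`0 < β' < 1/3`), then `u ∈ C^{β''}([0,T] × T³)` for every `β'' < β'`. The main result is
`Literature.Analysis.FluidPDE.BDSV.timeRegularity_holds : BDSV.timeRegularity`; together with
`OnsagerFlexibilityProofs` this reduces the trust base of `onsager_flexibility` (BDSV Thm. 1.1) to
the single named fact `BDSV.mainIteration` (BDSV Prop. 2.1).

## The argument (BDSV 2019, §2.2, "short and self-contained proof of the time-regularity")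

BDSV mollify in space, `ṽ = v ⋆ ψ_ℓ`, use `‖ṽ - v‖₀ ≲ [v]_{β'} ℓ^{β'}`, the equation
`∂ₜṽ + div(v ⊗ v) ⋆ ψ_ℓ + ∇p ⋆ ψ_ℓ = 0` with `-Δp = div div (v ⊗ v)`, Schauder estimates for
`∇p ⋆ ψ_ℓ`, and interpolate in time. We follow the same route with two substitutions that keep
the proof inside the tree's toolbox:

* the mollifier is the Gauss–Weierstrass kernel at `ℓ = √τ`, i.e. `ṽ = e^{τΔ}ṽ` is the caloric
  extension `Literature.Analysis.UnboundedOperators.heatExtension` of the periodic lift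
  (`HeatKernelBoundedData`: `‖e^{τΔ}g - g‖₀ ≲ [g]_β τ^{β/2}`, `‖∇e^{τΔ}g‖₀ ≲ [g]_β τ^{(β-1)/2}`);
* the Schauder estimate is replaced by the heat-flow representation of the mollified pressure
  gradient, `e^{τΔ}∂ᵥp = -∫_τ^∞ e^{σΔ} ∂ᵥΔp dσ` with `Δp = div div(R̊ - v ⊗ v)` and the third-order
  smoothing bound `‖e^{σΔ}∂³(v⊗v)‖₀ ≲ σ^{(β'-3)/2}[v⊗v]_{β'}` (`TorusHeatFlow`), which integrates to
  `‖e^{τΔ}∇p‖₀ ≲ [v⊗v]_{β'} τ^{(β'-1)/2} + ‖R̊‖₀ τ^{-1/2}` — the bound `‖∇p ⋆ ψ‖₀ ≲ ‖v‖²_{β'} ℓ^{β'-1}`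
  of BDSV without the `ε`-loss.

We work at level `q` (all fields smooth) and pass to the limit at the end, so no weak form of the
equations for `u` is needed: for interior times `0 < t₁ ≤ t₂ < T`,
`‖v_q(t₂) - v_q(t₁)‖₀ ≤ 2 c [v_q]_{β'} τ^{β'/2} + (t₂-t₁)(K_A ‖v_q‖₀[v_q]_{β'} τ^{(β'-1)/2} + K_B ‖R̊_q‖₀ τ^{-1/2})`
(`Torus.exists_norm_lift_sub_lift_le`, mean value inequality for `s ↦ e^{τΔ}ṽ_q(s)(x)` whose
derivative is `e^{τΔ}(∂ₜv_q)~` by dominated differentiation); letting `q → ∞` kills the stress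
term, and `τ = (t₂-t₁)²` gives `‖u(t₂) - u(t₁)‖₀ ≤ K |t₂-t₁|^{β'}`
(`BDSV.exists_norm_sub_le_of_unifLimit`), extended to `[0,T]` by continuity of `u`
(`BDSV.norm_sub_le_Icc_of_Ioo`). The spatial bound `[u(t)]_{β'} ≤ C` passes to the limit, the
product sup-metric combines the two, and `HolderOnWith.of_le` lowers the exponent to `β'' ≤ β'` on
the bounded set `[0,T] × T³`. (The statement is thus proved with `β'' = β'` as well, which is the
sharp form of Isett, arXiv:1307.0565, and Colombo–De Rosa 2020, Thm. 1.1, in this smooth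
approximation setting.)

## Contents

* `Torus.hasDerivAt_heatExtension_lift`: `∂ₛ e^{τΔ}ṽ(s)(x) = e^{τΔ}(∂ₜv(s))~(x)` at interior
  times (`hasDerivAt_integral_of_dominated_loc_of_deriv_le`).
* `Torus.exists_norm_heatExtension_lift_timeDerivWithin_le`: the bound on `e^{τΔ}(∂ₜv)~` for an
  Euler–Reynolds solution (via `EulerReynoldsPressure` and `TorusHeatFlow`).
* `Torus.exists_norm_lift_sub_lift_le`: the time increment before the limit.
* `BDSV.exists_norm_sub_le_of_unifLimit`, `BDSV.norm_sub_le_Icc_of_Ioo`,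
  `BDSV.holderWith_of_unifLimit`, `BDSV.holderOnWith_of_dist_le`, `BDSV.timeRegularity_holds`.

All constants are existentially quantified and depend only on the dimension and the Hölder
exponent; no definitions are introduced (pure proofs file).

## References

* T. Buckmaster, C. De Lellis, L. Székelyhidi Jr., V. Vicol, *Onsager's conjecture for admissible
  weak solutions*, Comm. Pure Appl. Math. 72 (2019) 229–274 = arXiv:1701.08678, §2.2, proof of
  Thm. 1.1 (time regularity, p. 6), and (2.2)–(2.3) (Euler–Reynolds system, pressure equation).
* P. Isett, *Regularity in time along the coarse scale flow for the incompressible Euler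
  equations*, arXiv:1307.0565.
* M. Colombo, L. De Rosa, *Regularity in time of Hölder solutions of Euler and hypodissipative
  Navier–Stokes equations*, SIAM J. Math. Anal. 52 (2020), Thm. 1.1.
* L. C. Evans, *Partial Differential Equations*, 2nd ed. (2010), §2.3.1 (heat kernel).
-/

noncomputable section

open MeasureTheory Set Filter Topology InnerProductSpace
open Literature.Analysis.UnboundedOperators Literature.Analysis.FunctionSpaces
open scoped Real ENNReal NNReal Laplacian ContDiff

namespace Literature.Analysis.FluidPDE

namespace Torus

variable {d : Type*} [Fintype d]
variable {F : Type*} [NormedAddCommGroup F] [NormedSpace ℝ F] [CompleteSpace F]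

/-! ## The heat flow of a lifted space–time field: time derivative under the integral sign -/

omit [CompleteSpace F] in
/-- **Time derivative of the mollified field.** For a field `v` jointly smooth on
`[0,T] × T^d`, `τ > 0`, `x ∈ ℝ^d` and an interior time `s ∈ (0,T)`, the caloric mollification
`s ↦ e^{τΔ} ṽ(s) (x)` is differentiable with derivative `e^{τΔ} (∂ₜv(s))~ (x)` (dominated
differentiation under the integral sign: the Gauss kernel is integrable and `∂ₜ v` is bounded on
the compact `[0,T] × T^d`). [folklore] -/
theorem hasDerivAt_heatExtension_lift {T : ℝ} (hT : 0 < T) {v : ℝ → UnitAddTorus d → F}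
    (hv : FunctionSpaces.Torus.IsSmoothSpaceTimeOn (Icc 0 T) v) {τ : ℝ} (hτ : 0 < τ)
    (x : EuclideanSpace ℝ d) {s : ℝ} (hs : s ∈ Ioo 0 T) :
    HasDerivAt (fun s => heatExtension (FunctionSpaces.Torus.lift (v s)) τ x)
      (heatExtension (FunctionSpaces.Torus.lift
        (FunctionSpaces.Torus.timeDerivWithin (Icc 0 T) v s)) τ x) s := by
  set w := FunctionSpaces.Torus.timeDerivWithin (Icc 0 T) v with hw_def
  have hw : FunctionSpaces.Torus.IsSmoothSpaceTimeOn (Icc 0 T) w := hv.timeDerivWithin (uniqueDiffOn_Icc hT)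
  obtain ⟨V, hV⟩ := hv.exists_norm_le_of_isCompact isCompact_Icc subset_rfl
  obtain ⟨B, hB⟩ := hw.exists_norm_le_of_isCompact isCompact_Icc subset_rfl
  have hIoo : Ioo 0 T ∈ 𝓝 s := Ioo_mem_nhds hs.1 hs.2
  have hcont : ∀ {u : ℝ → UnitAddTorus d → F}, FunctionSpaces.Torus.IsSmoothSpaceTimeOn (Icc 0 T) u →
      ∀ s' ∈ Ioo 0 T, Continuous fun y : EuclideanSpace ℝ d =>
        heatKernel τ y • FunctionSpaces.Torus.lift (u s') (x - y) := fun hu s' hs' =>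
    (continuous_heatKernel τ).smul ((FunctionSpaces.Torus.continuous_lift_iff.2
      (hu.isSmooth_slice (Ioo_subset_Icc_self hs')).continuous).comp (continuous_const.sub continuous_id))
  simp_rw [heatExtension_apply]
  have key := hasDerivAt_integral_of_dominated_loc_of_deriv_le (μ := volume) (𝕜 := ℝ)
    (F := fun s' y => heatKernel τ y • FunctionSpaces.Torus.lift (v s') (x - y))
    (F' := fun s' y => heatKernel τ y • FunctionSpaces.Torus.lift (w s') (x - y))
    (x₀ := s) (s := Ioo 0 T) (bound := fun y => heatKernel τ y * B) hIoo ?_ ?_ ?_ ?_ ?_ ?_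
  · exact key.2
  · filter_upwards [hIoo] with s' hs'
    exact (hcont hv s' hs').aestronglyMeasurable
  · exact integrable_heatKernel_smul_of_bound (FunctionSpaces.Torus.continuous_lift_iff.2
      (hv.isSmooth_slice (Ioo_subset_Icc_self hs)).continuous) (fun z => hV s (Ioo_subset_Icc_self hs) _) hτ x
  · exact (hcont hw s hs).aestronglyMeasurable
  · refine Eventually.of_forall fun y s' hs' => ?_
    rw [norm_smul, Real.norm_of_nonneg (heatKernel_pos hτ y).le]
    exact mul_le_mul_of_nonneg_left (hB s' (Ioo_subset_Icc_self hs') _) (heatKernel_pos hτ y).le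
  · exact (integrable_heatKernel_holds hτ).mul_const B
  · refine Eventually.of_forall fun y s' hs' => ?_
    have h1 := (hv.hasDerivWithinAt_slice (Ioo_subset_Icc_self hs')
      (FunctionSpaces.Torus.proj (x - y))).hasDerivAt (Icc_mem_nhds hs'.1 hs'.2)
    exact h1.const_smul (heatKernel τ y)

/-! ## Pointwise bound on `e^{τΔ} (∂ₜ v)~` for an Euler–Reynolds solution -/

variable [DecidableEq d]

/-- The `ℓ²` norm on `ℝ^d` is dominated by the `ℓ¹` norm: `‖V‖ ≤ Σᵢ |Vᵢ|`. [folklore] -/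
theorem norm_le_sum_abs (V : EuclideanSpace ℝ d) : ‖V‖ ≤ ∑ i, |V i| := by
  conv_lhs => rw [← (EuclideanSpace.basisFun d ℝ).sum_repr V]
  refine (norm_sum_le _ _).trans (Finset.sum_le_sum fun i _ => ?_)
  rw [EuclideanSpace.basisFun_repr, EuclideanSpace.basisFun_apply, norm_smul, Real.norm_eq_abs]
  simp

omit [DecidableEq d] in
/-- Hölder increments of the products `vᵢ vⱼ` of the components of a bounded Hölder field:
`|ṽᵢṽⱼ(y) - ṽᵢṽⱼ(z)| ≤ 2 V C ‖y - z‖^r` if `‖v‖ ≤ V` and `v` is `r`-Hölder with constant `C`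
(the bound `‖v ⊗ v‖_{β'} ≲ ‖v‖²_{β'}` of BDSV 2019, §2.2). [cite: BuckmasterEtAl2018, §2.2] -/
theorem abs_lift_mul_sub_le {v : UnitAddTorus d → EuclideanSpace ℝ d} {C r : ℝ≥0}
    (hH : HolderWith C r v) {V : ℝ} (hV : ∀ z, ‖v z‖ ≤ V) (i j : d) (y z : EuclideanSpace ℝ d) :
    ‖FunctionSpaces.Torus.lift (fun x => v x i * v x j) y -
        FunctionSpaces.Torus.lift (fun x => v x i * v x j) z‖ ≤ 2 * V * C * ‖y - z‖ ^ (r : ℝ) := by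
  have hinc := TorusHeat.norm_lift_sub_lift_le_of_holderWith hH y z
  simp only [FunctionSpaces.Torus.lift_apply] at hinc ⊢
  set a := v (FunctionSpaces.Torus.proj y) with ha
  set b := v (FunctionSpaces.Torus.proj z) with hb
  have hV0 : 0 ≤ V := (norm_nonneg _).trans (hV 0)
  have hai : |a i| ≤ V := (FunctionSpaces.Torus.abs_apply_le_norm a i).trans (hV _)
  have hbj : |b j| ≤ V := (FunctionSpaces.Torus.abs_apply_le_norm b j).trans (hV _)
  have hij : |a j - b j| ≤ C * ‖y - z‖ ^ (r : ℝ) := by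
    rw [← PiLp.sub_apply]; exact (FunctionSpaces.Torus.abs_apply_le_norm (a - b) j).trans hinc
  have hii : |a i - b i| ≤ C * ‖y - z‖ ^ (r : ℝ) := by
    rw [← PiLp.sub_apply]; exact (FunctionSpaces.Torus.abs_apply_le_norm (a - b) i).trans hinc
  have hD : 0 ≤ (C : ℝ) * ‖y - z‖ ^ (r : ℝ) := by positivity
  rw [Real.norm_eq_abs]
  calc |a i * a j - b i * b j| = |a i * (a j - b j) + (a i - b i) * b j| := by ring_nf
    _ ≤ |a i| * |a j - b j| + |a i - b i| * |b j| := by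
        refine (abs_add_le _ _).trans ?_
        rw [abs_mul, abs_mul]
    _ ≤ V * (C * ‖y - z‖ ^ (r : ℝ)) + (C * ‖y - z‖ ^ (r : ℝ)) * V :=
        add_le_add (mul_le_mul hai hij (abs_nonneg _) hV0) (mul_le_mul hii hbj (abs_nonneg _) hD)
    _ = 2 * V * C * ‖y - z‖ ^ (r : ℝ) := by ring

omit [CompleteSpace F] [DecidableEq d] in
/-- The heat flow of a single finite sum of lifted continuous data. [folklore] -/
theorem heatExtension_sum_lift {g : d → UnitAddTorus d → F} (hg : ∀ j, Continuous (g j))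
    {σ : ℝ} (hσ : 0 < σ) (x : EuclideanSpace ℝ d) :
    heatExtension (fun z => ∑ j, FunctionSpaces.Torus.lift (g j) z) σ x =
      ∑ j, heatExtension (FunctionSpaces.Torus.lift (g j)) σ x := by
  choose C _ hC using fun j => TorusHeat.exists_norm_le (hg j)
  exact heatExtension_finset_sum _ _ _ fun j _ =>
    integrable_heatKernel_smul_of_bound (FunctionSpaces.Torus.continuous_lift_iff.2 (hg j))
      (fun z => hC j _) hσ x

variable {T : ℝ} {v : ℝ → UnitAddTorus d → EuclideanSpace ℝ d} {p : ℝ → UnitAddTorus d → ℝ}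
  {R : ℝ → UnitAddTorus d → d → EuclideanSpace ℝ d}

/-- **Bound on the mollified time derivative** (BDSV 2019, §2.2, display
`‖∂ₜ ṽ_q‖₀ ≲ ‖v‖²_{β'} 2^{q(1+ε-β')}`, here without the `ε`-loss and with the Reynolds stress kept):
for a classical Euler–Reynolds solution on `[0,T] × T^d`, an interior time `s`, a velocity slice
with `‖v(s)‖ ≤ V` and `r`-Hölder constant `C` (`0 < r < 1`), a stress slice with `‖R̊(s)‖ ≤ ρ`,
and `τ > 0`,
`‖e^{τΔ} (∂ₜv(s))~ (x)‖ ≤ K_A (2VC) τ^{(r-1)/2} + K_B ρ τ^{-1/2}`,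
from `∂ₜv = div R̊ - ∇p - div(v ⊗ v)`, the mollification estimates and the pressure bound
`norm_heatExtension_lift_lineDeriv_le_of_laplacian_eq`. [cite: BuckmasterEtAl2018, §2.2 (proof of Thm. 1.1, time regularity)] -/
theorem exists_norm_heatExtension_lift_timeDerivWithin_le (d : Type*) [Fintype d] [DecidableEq d]
    {r : ℝ≥0} (hr0 : 0 < r) (hr1 : r < 1) :
    ∃ KA KB : ℝ, 0 ≤ KA ∧ 0 ≤ KB ∧
      ∀ {T : ℝ} {v : ℝ → UnitAddTorus d → EuclideanSpace ℝ d} {p : ℝ → UnitAddTorus d → ℝ}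
        {R : ℝ → UnitAddTorus d → d → EuclideanSpace ℝ d} (_h : IsEulerReynoldsOn (Icc 0 T) v p R)
        {s : ℝ} (_hs : s ∈ Ioo 0 T) {C : ℝ≥0} (_hH : HolderWith C r (v s))
        {V : ℝ} (_hV : ∀ z, ‖v s z‖ ≤ V) {ρ : ℝ} (_hρ : ∀ z, ‖R s z‖ ≤ ρ) {τ : ℝ} (_hτ : 0 < τ)
        (x : EuclideanSpace ℝ d),
        ‖heatExtension (FunctionSpaces.Torus.lift (FunctionSpaces.Torus.timeDerivWithin (Icc 0 T) v s)) τ x‖ ≤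
          KA * (V * C) * τ ^ (((r : ℝ) - 1) / 2) + KB * ρ * τ ^ (-(1 / 2 : ℝ)) := by
  -- the constants
  obtain ⟨KF, KG, hKF, hKG, hP⟩ :=
    TorusHeat.exists_norm_heatExtension_lift_lineDeriv_le_of_laplacian_eq d (β := (r : ℝ))
      (by exact_mod_cast hr0.le) (by exact_mod_cast hr1)
  set c : ℝ := (2 : ℝ) ^ ((Module.finrank ℝ (EuclideanSpace ℝ d) : ℝ) / 2) with hc
  set cH : ℝ := (1 + 2 * (2 : ℝ) ^ ((Module.finrank ℝ (EuclideanSpace ℝ d) : ℝ) / 2)) with hcH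
  have hc0 : 0 < c := Real.rpow_pos_of_pos two_pos _
  have hcH0 : 0 < cH := by rw [hcH]; positivity
  set KA : ℝ := 2 * (Fintype.card d : ℝ) * (KG + (Fintype.card d : ℝ) * c * cH * (2 : ℝ) ^ ((r : ℝ) / 2)) with hKA
  set KB : ℝ := (Fintype.card d : ℝ) * ((Fintype.card d : ℝ) * c + KF) with hKB
  refine ⟨KA, KB, by positivity, by positivity, ?_⟩
  intro T v p R h s hs C hH V hV ρ hρ τ hτ x
  have hsI : s ∈ Icc 0 T := Ioo_subset_Icc_self hs
  have hsint : s ∈ interior (Icc 0 T) := by rw [interior_Icc]; exact hs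
  have hvs : FunctionSpaces.Torus.IsSmooth (v s) := h.smooth_velocity.isSmooth_slice hsI
  have hps : FunctionSpaces.Torus.IsSmooth (p s) := h.smooth_pressure.isSmooth_slice hsI
  have hRs : FunctionSpaces.Torus.IsSmooth (R s) := h.smooth_stress.isSmooth_slice hsI
  have hV0 : 0 ≤ V := (norm_nonneg _).trans (hV 0)
  have hρ0 : 0 ≤ ρ := (norm_nonneg _).trans (hρ 0)
  set e : d → EuclideanSpace ℝ d := fun i => EuclideanSpace.single i (1 : ℝ) with he_def
  have he : ∀ i, ‖e i‖ = 1 := fun i => by simp [he_def]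
  -- the three families of smooth torus functions entering `∂ₜ v`
  set Fs : d → d → UnitAddTorus d → ℝ := fun i j z => R s z j i with hFs_def
  set Gs : d → d → UnitAddTorus d → ℝ := fun i j z => v s z i * v s z j with hGs_def
  have hFs : ∀ i j, FunctionSpaces.Torus.IsSmooth (Fs i j) := fun i j => (hRs.column j).apply i
  have hGs : ∀ i j, FunctionSpaces.Torus.IsSmooth (Gs i j) := fun i j => by
    have := (hvs.apply i).smul' (hvs.apply j)
    simpa [hGs_def, smul_eq_mul] using this
  have hFb : ∀ i j z, ‖Fs i j z‖ ≤ ρ := fun i j z => by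
    simp only [hFs_def, Real.norm_eq_abs]
    exact (FunctionSpaces.Torus.abs_apply_le_norm (R s z j) i).trans ((norm_le_pi_norm (R s z) j).trans (hρ z))
  have hA : 0 ≤ 2 * V * C := by positivity
  have hGH : ∀ i j y z, ‖FunctionSpaces.Torus.lift (Gs i j) y - FunctionSpaces.Torus.lift (Gs i j) z‖ ≤
      2 * V * C * ‖y - z‖ ^ (r : ℝ) := fun i j y z => abs_lift_mul_sub_le hH hV i j y z
  set D : EuclideanSpace ℝ d → (UnitAddTorus d → ℝ) → UnitAddTorus d → ℝ :=
    fun w g z => FunctionSpaces.Torus.lineDeriv g z w with hD_def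
  -- the lifted time derivative, componentwise
  set Ψ := FunctionSpaces.Torus.lift (FunctionSpaces.Torus.timeDerivWithin (Icc 0 T) v s) with hΨ_def
  have hΨcomp : ∀ i, (fun z => Ψ z i) = fun z =>
      (∑ j, FunctionSpaces.Torus.lift (D (e j) (Fs i j)) z - FunctionSpaces.Torus.lift (D (e i) (p s)) z) -
        ∑ j, FunctionSpaces.Torus.lift (D (e j) (Gs i j)) z := by
    intro i
    funext z
    have hderiv : Ψ z = deriv (fun s' => FunctionSpaces.Torus.lift (v s') z) s := by
      rw [hΨ_def, FunctionSpaces.Torus.lift_apply, FunctionSpaces.Torus.timeDerivWithin_of_mem_interior hsint]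
      rfl
    rw [hderiv, h.deriv_lift_velocity_apply hsint z i]
    simp only [hD_def, ← TorusHeat.fderiv_lift_apply_eq (hFs _ _), ← TorusHeat.fderiv_lift_apply_eq hps,
      ← TorusHeat.fderiv_lift_apply_eq (hGs _ _)]
    rfl
  -- continuity of `Ψ` and the componentwise heat flow
  have hΨsm : FunctionSpaces.Torus.IsSmooth (FunctionSpaces.Torus.timeDerivWithin (Icc 0 T) v s) :=
    (h.smooth_velocity.timeDerivWithin (uniqueDiffOn_Icc (hs.1.trans hs.2))).isSmooth_slice hsI
  obtain ⟨CΨ, -, hCΨ⟩ := TorusHeat.exists_norm_lift_le hΨsm.continuous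
  have hcomp : ∀ i, heatExtension Ψ τ x i = heatExtension (fun z => Ψ z i) τ x := fun i => by
    have := heatExtension_clm_comp_of_bound (EuclideanSpace.proj i : EuclideanSpace ℝ d →L[ℝ] ℝ)
      (FunctionSpaces.Torus.continuous_lift_iff.2 hΨsm.continuous) hCΨ hτ x
    exact this.symm
  -- linearity of the heat flow on each component
  have hDs : ∀ {g : UnitAddTorus d → ℝ}, FunctionSpaces.Torus.IsSmooth g → ∀ w,
      FunctionSpaces.Torus.IsSmooth (D w g) := fun hg w => hg.lineDeriv w
  have hlin : ∀ i, heatExtension (fun z => Ψ z i) τ x =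
      (∑ j, heatExtension (FunctionSpaces.Torus.lift (D (e j) (Fs i j))) τ x -
        heatExtension (FunctionSpaces.Torus.lift (D (e i) (p s))) τ x) -
      ∑ j, heatExtension (FunctionSpaces.Torus.lift (D (e j) (Gs i j))) τ x := by
    intro i
    rw [hΨcomp i]
    choose CF _ hCF using fun j => TorusHeat.exists_norm_le (hDs (hFs i j) (e j)).continuous
    choose CG _ hCG using fun j => TorusHeat.exists_norm_le (hDs (hGs i j) (e j)).continuous
    obtain ⟨CP, -, hCP⟩ := TorusHeat.exists_norm_le (hDs hps (e i)).continuous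
    have hc1 : Continuous fun z : EuclideanSpace ℝ d => ∑ j, FunctionSpaces.Torus.lift (D (e j) (Fs i j)) z :=
      continuous_finsetSum _ fun j _ => FunctionSpaces.Torus.continuous_lift_iff.2 (hDs (hFs i j) (e j)).continuous
    have hc2 : Continuous fun z : EuclideanSpace ℝ d => FunctionSpaces.Torus.lift (D (e i) (p s)) z :=
      FunctionSpaces.Torus.continuous_lift_iff.2 (hDs hps (e i)).continuous
    have hc3 : Continuous fun z : EuclideanSpace ℝ d => ∑ j, FunctionSpaces.Torus.lift (D (e j) (Gs i j)) z :=
      continuous_finsetSum _ fun j _ => FunctionSpaces.Torus.continuous_lift_iff.2 (hDs (hGs i j) (e j)).continuous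
    have hb1 : ∀ z : EuclideanSpace ℝ d, ‖∑ j, FunctionSpaces.Torus.lift (D (e j) (Fs i j)) z‖ ≤ ∑ j, CF j :=
      fun z => (norm_sum_le _ _).trans (Finset.sum_le_sum fun j _ => hCF j _)
    have hb3 : ∀ z : EuclideanSpace ℝ d, ‖∑ j, FunctionSpaces.Torus.lift (D (e j) (Gs i j)) z‖ ≤ ∑ j, CG j :=
      fun z => (norm_sum_le _ _).trans (Finset.sum_le_sum fun j _ => hCG j _)
    have hb12 : ∀ z : EuclideanSpace ℝ d, ‖∑ j, FunctionSpaces.Torus.lift (D (e j) (Fs i j)) z -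
        FunctionSpaces.Torus.lift (D (e i) (p s)) z‖ ≤ ∑ j, CF j + CP :=
      fun z => (norm_sub_le _ _).trans (add_le_add (hb1 z) (hCP _))
    have hc12 : Continuous fun z : EuclideanSpace ℝ d => ∑ j, FunctionSpaces.Torus.lift (D (e j) (Fs i j)) z -
        FunctionSpaces.Torus.lift (D (e i) (p s)) z := hc1.sub hc2
    rw [heatExtension_sub_of_bound hc12 hc3 hb12 hb3 hτ x,
      heatExtension_sub_of_bound hc1 hc2 hb1 (fun z => hCP _) hτ x,
      heatExtension_sum_lift (fun j => (hDs (hFs i j) (e j)).continuous) hτ x,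
      heatExtension_sum_lift (fun j => (hDs (hGs i j) (e j)).continuous) hτ x]
  -- the three bounds
  have hbF : ∀ i j, ‖heatExtension (FunctionSpaces.Torus.lift (D (e j) (Fs i j))) τ x‖ ≤
      c * τ ^ (-(1 / 2 : ℝ)) * ρ := fun i j => by
    have := TorusHeat.norm_heatExtension_lift_lineDeriv_le_of_bound (hFs i j) (hFb i j) hτ x (e j)
    rwa [he, mul_one] at this
  have hbP : ∀ i, ‖heatExtension (FunctionSpaces.Torus.lift (D (e i) (p s))) τ x‖ ≤
      KF * ρ * τ ^ (-(1 / 2 : ℝ)) + KG * (2 * V * C) * τ ^ (((r : ℝ) - 1) / 2) := fun i => by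
    have := hP hps hFs hGs hFb hA hGH (h.laplacian_lift_pressure hsint) hτ x (e i)
    rwa [he, mul_one] at this
  have hbG : ∀ i j, ‖heatExtension (FunctionSpaces.Torus.lift (D (e j) (Gs i j))) τ x‖ ≤
      c * τ ^ (-(1 / 2 : ℝ)) * (cH * (2 * τ) ^ ((r : ℝ) / 2)) * (2 * V * C) := fun i j => by
    have := TorusHeat.norm_heatExtension_lift_lineDeriv_le_of_holder (hGs i j) hA (by exact_mod_cast hr0.le)
      (by exact_mod_cast hr1.le) (hGH i j) hτ x (e j)
    rwa [he, mul_one] at this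
  -- assemble
  have hτr : τ ^ (-(1 / 2 : ℝ)) * (2 * τ) ^ ((r : ℝ) / 2) = (2 : ℝ) ^ ((r : ℝ) / 2) * τ ^ (((r : ℝ) - 1) / 2) := by
    rw [Real.mul_rpow (by norm_num) hτ.le, show ((r : ℝ) - 1) / 2 = -(1 / 2 : ℝ) + (r : ℝ) / 2 by ring,
      Real.rpow_add hτ]
    ring
  calc ‖heatExtension Ψ τ x‖ ≤ ∑ i, |heatExtension Ψ τ x i| := norm_le_sum_abs _
    _ = ∑ i, ‖heatExtension (fun z => Ψ z i) τ x‖ := by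
        refine Finset.sum_congr rfl fun i _ => ?_
        rw [hcomp i, Real.norm_eq_abs]
    _ ≤ ∑ _i : d, ((Fintype.card d : ℝ) * (c * τ ^ (-(1 / 2 : ℝ)) * ρ) +
          (KF * ρ * τ ^ (-(1 / 2 : ℝ)) + KG * (2 * V * C) * τ ^ (((r : ℝ) - 1) / 2)) +
          (Fintype.card d : ℝ) * (c * τ ^ (-(1 / 2 : ℝ)) * (cH * (2 * τ) ^ ((r : ℝ) / 2)) * (2 * V * C))) := by
        refine Finset.sum_le_sum fun i _ => ?_
        rw [hlin i]
        refine (norm_sub_le _ _).trans (add_le_add ((norm_sub_le _ _).trans (add_le_add ?_ (hbP i))) ?_)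
        · refine (norm_sum_le _ _).trans ((Finset.sum_le_sum fun j _ => hbF i j).trans ?_)
          simp
        · refine (norm_sum_le _ _).trans ((Finset.sum_le_sum fun j _ => hbG i j).trans ?_)
          simp
    _ = KA * (V * C) * τ ^ (((r : ℝ) - 1) / 2) + KB * ρ * τ ^ (-(1 / 2 : ℝ)) := by
        simp only [Finset.sum_const, Finset.card_univ, nsmul_eq_mul, hKA, hKB]
        rw [show c * τ ^ (-(1 / 2 : ℝ)) * (cH * (2 * τ) ^ ((r : ℝ) / 2)) =
          c * cH * (τ ^ (-(1 / 2 : ℝ)) * (2 * τ) ^ ((r : ℝ) / 2)) by ring, hτr]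
        ring

/-! ## The time increment of the velocity before the limit -/

/-- **The time increment of an Euler–Reynolds velocity through its caloric mollification**
(BDSV 2019, §2.2: `‖ṽ - v‖₀ ≲ [v]_{β'} ℓ^{β'}` twice plus `|t₂ - t₁| ‖∂ₜṽ‖₀`). For interior
times `0 < t₁ ≤ t₂ < T`, uniform bounds `‖v‖ ≤ V`, `[v(t)]_r ≤ C`, `‖R̊‖ ≤ ρ` on `[0,T]`, every
`τ > 0` and every `y ∈ ℝ^d`:
`‖ṽ(t₂,y) - ṽ(t₁,y)‖ ≤ 2 c_H C τ^{r/2} + (t₂ - t₁)(K_A V C τ^{(r-1)/2} + K_B ρ τ^{-1/2})`.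
[cite: BuckmasterEtAl2018, §2.2 (proof of Thm. 1.1, time regularity)] -/
theorem exists_norm_lift_sub_lift_le (d : Type*) [Fintype d] [DecidableEq d]
    {r : ℝ≥0} (hr0 : 0 < r) (hr1 : r < 1) :
    ∃ K₀ KA KB : ℝ, 0 ≤ K₀ ∧ 0 ≤ KA ∧ 0 ≤ KB ∧
      ∀ {T : ℝ} {v : ℝ → UnitAddTorus d → EuclideanSpace ℝ d} {p : ℝ → UnitAddTorus d → ℝ}
        {R : ℝ → UnitAddTorus d → d → EuclideanSpace ℝ d} (_h : IsEulerReynoldsOn (Icc 0 T) v p R)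
        (_hT : 0 < T) {t₁ t₂ : ℝ} (_ht₁ : 0 < t₁) (_ht₁₂ : t₁ ≤ t₂) (_ht₂ : t₂ < T) {C : ℝ≥0}
        (_hH : ∀ t ∈ Icc 0 T, HolderWith C r (v t)) {V : ℝ} (_hV : ∀ t ∈ Icc 0 T, ∀ z, ‖v t z‖ ≤ V)
        {ρ : ℝ} (_hρ : ∀ t ∈ Icc 0 T, ∀ z, ‖R t z‖ ≤ ρ) {τ : ℝ} (_hτ : 0 < τ) (y : EuclideanSpace ℝ d),
        ‖FunctionSpaces.Torus.lift (v t₂) y - FunctionSpaces.Torus.lift (v t₁) y‖ ≤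
          2 * (K₀ * C * τ ^ ((r : ℝ) / 2)) +
            (t₂ - t₁) * (KA * (V * C) * τ ^ (((r : ℝ) - 1) / 2) + KB * ρ * τ ^ (-(1 / 2 : ℝ))) := by
  obtain ⟨KA, KB, hKA, hKB, hB⟩ := exists_norm_heatExtension_lift_timeDerivWithin_le d hr0 hr1
  set K₀ : ℝ := (1 + 2 * (2 : ℝ) ^ ((Module.finrank ℝ (EuclideanSpace ℝ d) : ℝ) / 2)) with hK₀
  refine ⟨K₀, KA, KB, by positivity, hKA, hKB, ?_⟩
  intro T v p R h hT t₁ t₂ ht₁ ht₁₂ ht₂ C hH V hV ρ hρ τ hτ y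
  have hI : ∀ t ∈ Icc t₁ t₂, t ∈ Ioo 0 T := fun t ht => ⟨ht₁.trans_le ht.1, ht.2.trans_lt ht₂⟩
  have hI' : ∀ t ∈ Icc t₁ t₂, t ∈ Icc 0 T := fun t ht => Ioo_subset_Icc_self (hI t ht)
  -- the mollification error at a fixed time
  have hmoll : ∀ t ∈ Icc 0 T, ‖heatExtension (FunctionSpaces.Torus.lift (v t)) τ y -
      FunctionSpaces.Torus.lift (v t) y‖ ≤ K₀ * C * τ ^ ((r : ℝ) / 2) := by
    intro t ht
    have hc : Continuous (FunctionSpaces.Torus.lift (v t)) :=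
      FunctionSpaces.Torus.continuous_lift_iff.2 (h.smooth_velocity.isSmooth_slice ht).continuous
    exact norm_heatExtension_sub_self_le_of_holder hc (fun z => hV t ht _) C.coe_nonneg
      (by exact_mod_cast hr0.le) (by exact_mod_cast hr1.le)
      (TorusHeat.norm_lift_sub_lift_le_of_holderWith (hH t ht)) hτ y
  -- the mean value inequality for the mollified velocity on `[t₁, t₂]`
  set M := KA * (V * C) * τ ^ (((r : ℝ) - 1) / 2) + KB * ρ * τ ^ (-(1 / 2 : ℝ)) with hM
  have hMVT : ‖heatExtension (FunctionSpaces.Torus.lift (v t₂)) τ y -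
      heatExtension (FunctionSpaces.Torus.lift (v t₁)) τ y‖ ≤ M * (t₂ - t₁) := by
    refine norm_image_sub_le_of_norm_deriv_le_segment'
      (f := fun s => heatExtension (FunctionSpaces.Torus.lift (v s)) τ y)
      (fun t ht => (hasDerivAt_heatExtension_lift hT h.smooth_velocity hτ y (hI t ht)).hasDerivWithinAt)
      (fun t ht => ?_) t₂ (right_mem_Icc.2 ht₁₂)
    exact hB h (hI t (Ico_subset_Icc_self ht)) (hH t (hI' t (Ico_subset_Icc_self ht)))
      (hV t (hI' t (Ico_subset_Icc_self ht))) (hρ t (hI' t (Ico_subset_Icc_self ht))) hτ y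
  have h1 := hmoll t₁ (hI' t₁ (left_mem_Icc.2 ht₁₂))
  have h2 := hmoll t₂ (hI' t₂ (right_mem_Icc.2 ht₁₂))
  calc ‖FunctionSpaces.Torus.lift (v t₂) y - FunctionSpaces.Torus.lift (v t₁) y‖
      = ‖-(heatExtension (FunctionSpaces.Torus.lift (v t₂)) τ y - FunctionSpaces.Torus.lift (v t₂) y) +
          (heatExtension (FunctionSpaces.Torus.lift (v t₂)) τ y -
            heatExtension (FunctionSpaces.Torus.lift (v t₁)) τ y) +
          (heatExtension (FunctionSpaces.Torus.lift (v t₁)) τ y - FunctionSpaces.Torus.lift (v t₁) y)‖ := by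
        congr 1; abel
    _ ≤ ‖heatExtension (FunctionSpaces.Torus.lift (v t₂)) τ y - FunctionSpaces.Torus.lift (v t₂) y‖ +
          ‖heatExtension (FunctionSpaces.Torus.lift (v t₂)) τ y -
            heatExtension (FunctionSpaces.Torus.lift (v t₁)) τ y‖ +
          ‖heatExtension (FunctionSpaces.Torus.lift (v t₁)) τ y - FunctionSpaces.Torus.lift (v t₁) y‖ := by
        refine (norm_add_le _ _).trans (add_le_add ((norm_add_le _ _).trans (add_le_add ?_ le_rfl)) le_rfl)
        rw [norm_neg]
    _ ≤ K₀ * C * τ ^ ((r : ℝ) / 2) + M * (t₂ - t₁) + K₀ * C * τ ^ ((r : ℝ) / 2) :=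
        add_le_add (add_le_add h2 hMVT) h1
    _ = _ := by rw [hM]; ring

end Torus

/-! ## The limit `q → ∞`: time regularity of the uniform limit -/

namespace BDSV

variable {d : Type*} [Fintype d] [DecidableEq d]

variable {T : ℝ} {v : ℕ → ℝ → UnitAddTorus d → EuclideanSpace ℝ d} {p : ℕ → ℝ → UnitAddTorus d → ℝ}
  {R : ℕ → ℝ → UnitAddTorus d → d → EuclideanSpace ℝ d} {u : ℝ → UnitAddTorus d → EuclideanSpace ℝ d}

/-- **Time regularity at interior times** (BDSV 2019, §2.2). Let `(v_q, p_q, R̊_q)` be classical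
Euler–Reynolds solutions on `[0,T] × T^d` with `v_q → u` uniformly, `‖R̊_q‖₀ → 0`, `[v_q(t)]_r ≤ C`
and `‖v_q‖ ≤ V` for `q ≥ N₁` (`0 < r < 1`). Then for `0 < t₁ ≤ t₂ < T` and every `x`,
`‖u(t₂,x) - u(t₁,x)‖ ≤ (2 c_H C + K_A V C) (t₂ - t₁)^r`: apply
`IsEulerReynoldsOn.norm_lift_sub_lift_le` with `τ = (t₂ - t₁)²` and let `q → ∞` (the stress
term disappears). [cite: BuckmasterEtAl2018, §2.2 (proof of Thm. 1.1, time regularity)] -/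
theorem exists_norm_sub_le_of_unifLimit (d : Type*) [Fintype d] [DecidableEq d]
    {r : ℝ≥0} (hr0 : 0 < r) (hr1 : r < 1) :
    ∃ K₀ KA : ℝ, 0 ≤ K₀ ∧ 0 ≤ KA ∧
      ∀ {T : ℝ} (_hT : 0 < T) {v : ℕ → ℝ → UnitAddTorus d → EuclideanSpace ℝ d}
        {p : ℕ → ℝ → UnitAddTorus d → ℝ} {R : ℕ → ℝ → UnitAddTorus d → d → EuclideanSpace ℝ d}
        {u : ℝ → UnitAddTorus d → EuclideanSpace ℝ d}
        (_hE : ∀ q, Torus.IsEulerReynoldsOn (Icc 0 T) (v q) (p q) (R q))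
        (_hv : ∀ ε > 0, ∃ N : ℕ, ∀ q ≥ N, ∀ t ∈ Icc 0 T, ∀ x, ‖v q t x - u t x‖ ≤ ε)
        (_hR : ∀ ε > 0, ∃ N : ℕ, ∀ q ≥ N, ∀ t ∈ Icc 0 T, ∀ x, ‖R q t x‖ ≤ ε)
        {C : ℝ≥0} (_hH : ∀ q, ∀ t ∈ Icc 0 T, HolderWith C r (v q t)) {N₁ : ℕ} {V : ℝ}
        (_hV : ∀ q, N₁ ≤ q → ∀ t ∈ Icc 0 T, ∀ z, ‖v q t z‖ ≤ V) {t₁ t₂ : ℝ} (_ht₁ : 0 < t₁)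
        (_ht₁₂ : t₁ ≤ t₂) (_ht₂ : t₂ < T) (x : UnitAddTorus d),
        ‖u t₂ x - u t₁ x‖ ≤ (2 * K₀ * C + KA * (V * C)) * (t₂ - t₁) ^ (r : ℝ) := by
  obtain ⟨K₀, KA, KB, hK₀, hKA, hKB, hS⟩ := Torus.exists_norm_lift_sub_lift_le d hr0 hr1
  refine ⟨K₀, KA, hK₀, hKA, ?_⟩
  intro T hT v p R u hE hv hR C hH N₁ V hV t₁ t₂ ht₁ ht₁₂ ht₂ x
  rcases eq_or_lt_of_le ht₁₂ with heq | hlt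
  · subst heq
    simp [Real.zero_rpow (by exact_mod_cast hr0.ne' : (r : ℝ) ≠ 0)]
  obtain ⟨y, rfl⟩ := FunctionSpaces.Torus.proj_surjective x
  have hδ : 0 < t₂ - t₁ := sub_pos.2 hlt
  set τ : ℝ := (t₂ - t₁) ^ 2 with hτ_def
  have hτ : 0 < τ := by positivity
  -- the two powers of `τ`
  have hτ1 : τ ^ ((r : ℝ) / 2) = (t₂ - t₁) ^ (r : ℝ) := by
    rw [hτ_def, ← Real.rpow_natCast, ← Real.rpow_mul hδ.le]
    congr 1; push_cast; ring
  have hτ2 : (t₂ - t₁) * τ ^ (((r : ℝ) - 1) / 2) = (t₂ - t₁) ^ (r : ℝ) := by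
    rw [hτ_def, ← Real.rpow_natCast, ← Real.rpow_mul hδ.le,
      show ((2 : ℕ) : ℝ) * (((r : ℝ) - 1) / 2) = (r : ℝ) - 1 by push_cast; ring,
      Real.rpow_sub_one hδ.ne', mul_div_cancel₀ _ hδ.ne']
  refine le_of_forall_pos_le_add fun ε hε => ?_
  -- choose the stress so small that its contribution is below `ε/2`
  set L : ℝ := (t₂ - t₁) * (KB * τ ^ (-(1 / 2 : ℝ))) with hL
  have hL0 : 0 ≤ L := by positivity
  obtain ⟨N₂, hN₂⟩ := hR (ε / (2 * (L + 1))) (by positivity)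
  obtain ⟨N₃, hN₃⟩ := hv (ε / 4) (by positivity)
  set q := max N₁ (max N₂ N₃) with hq
  have hq₁ : N₁ ≤ q := le_max_left _ _
  have hq₂ : N₂ ≤ q := (le_max_left _ _).trans (le_max_right _ _)
  have hq₃ : N₃ ≤ q := (le_max_right _ _).trans (le_max_right _ _)
  have hinc := hS (hE q) hT ht₁ ht₁₂ ht₂ (hH q) (hV q hq₁) (fun t ht z => hN₂ q hq₂ t ht z) hτ y
  have ht₁I : t₁ ∈ Icc 0 T := ⟨ht₁.le, ht₁₂.trans ht₂.le⟩
  have ht₂I : t₂ ∈ Icc 0 T := ⟨ht₁.le.trans ht₁₂, ht₂.le⟩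
  have e₁ := hN₃ q hq₃ t₁ ht₁I (FunctionSpaces.Torus.proj y)
  have e₂ := hN₃ q hq₃ t₂ ht₂I (FunctionSpaces.Torus.proj y)
  simp only [FunctionSpaces.Torus.lift_apply] at hinc
  -- the stress contribution
  have hstress : (t₂ - t₁) * (KB * (ε / (2 * (L + 1))) * τ ^ (-(1 / 2 : ℝ))) ≤ ε / 2 := by
    have h1 : (t₂ - t₁) * (KB * (ε / (2 * (L + 1))) * τ ^ (-(1 / 2 : ℝ))) = L / (L + 1) * (ε / 2) := by
      rw [hL]; field_simp
    rw [h1]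
    have h2 : L / (L + 1) ≤ 1 := (div_le_one (by positivity)).2 (by linarith)
    calc L / (L + 1) * (ε / 2) ≤ 1 * (ε / 2) := mul_le_mul_of_nonneg_right h2 (by positivity)
      _ = ε / 2 := one_mul _
  calc ‖u t₂ (FunctionSpaces.Torus.proj y) - u t₁ (FunctionSpaces.Torus.proj y)‖
      = ‖(v q t₂ (FunctionSpaces.Torus.proj y) - v q t₁ (FunctionSpaces.Torus.proj y)) -
          (v q t₂ (FunctionSpaces.Torus.proj y) - u t₂ (FunctionSpaces.Torus.proj y)) +
          (v q t₁ (FunctionSpaces.Torus.proj y) - u t₁ (FunctionSpaces.Torus.proj y))‖ := by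
        congr 1; abel
    _ ≤ ‖v q t₂ (FunctionSpaces.Torus.proj y) - v q t₁ (FunctionSpaces.Torus.proj y)‖ +
          ‖v q t₂ (FunctionSpaces.Torus.proj y) - u t₂ (FunctionSpaces.Torus.proj y)‖ +
          ‖v q t₁ (FunctionSpaces.Torus.proj y) - u t₁ (FunctionSpaces.Torus.proj y)‖ :=
        (norm_add_le _ _).trans (add_le_add (norm_sub_le _ _) le_rfl)
    _ ≤ (2 * (K₀ * C * τ ^ ((r : ℝ) / 2)) +
          (t₂ - t₁) * (KA * (V * C) * τ ^ (((r : ℝ) - 1) / 2) +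
            KB * (ε / (2 * (L + 1))) * τ ^ (-(1 / 2 : ℝ)))) + ε / 4 + ε / 4 :=
        add_le_add (add_le_add hinc e₂) e₁
    _ = (2 * K₀ * C + KA * (V * C)) * (t₂ - t₁) ^ (r : ℝ) +
          ((t₂ - t₁) * (KB * (ε / (2 * (L + 1))) * τ ^ (-(1 / 2 : ℝ))) + ε / 2) := by
        rw [hτ1, ← hτ2]; ring
    _ ≤ (2 * K₀ * C + KA * (V * C)) * (t₂ - t₁) ^ (r : ℝ) + (ε / 2 + ε / 2) :=
        add_le_add le_rfl (add_le_add hstress le_rfl)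
    _ = (2 * K₀ * C + KA * (V * C)) * (t₂ - t₁) ^ (r : ℝ) + ε := by ring

omit [Fintype d] [DecidableEq d] in
/-- **Time regularity on the closed interval**: a bound `‖u(t₂) - u(t₁)‖ ≤ K (t₂-t₁)^r` for
interior times `0 < t₁ ≤ t₂ < T` extends to all `t₁ ≤ t₂` in `[0,T]` when `u` is continuous on
`[0,T] × T^d` (approximate the endpoints from inside). [folklore] -/
theorem norm_sub_le_Icc_of_Ioo {F' : Type*} [NormedAddCommGroup F'] {u : ℝ → UnitAddTorus d → F'}
    (huc : ContinuousOn (FunctionSpaces.Torus.stLift u) (Icc 0 T ×ˢ univ)) {r : ℝ≥0} (hr0 : 0 < r) {K : ℝ}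
    (hK : ∀ t₁ t₂ : ℝ, 0 < t₁ → t₁ ≤ t₂ → t₂ < T → ∀ x, ‖u t₂ x - u t₁ x‖ ≤ K * (t₂ - t₁) ^ (r : ℝ))
    {t₁ t₂ : ℝ} (ht₁ : t₁ ∈ Icc 0 T) (ht₂ : t₂ ∈ Icc 0 T) (ht₁₂ : t₁ ≤ t₂) (x : UnitAddTorus d) :
    ‖u t₂ x - u t₁ x‖ ≤ K * (t₂ - t₁) ^ (r : ℝ) := by
  rcases eq_or_lt_of_le ht₁₂ with heq | hlt
  · subst heq
    simp [Real.zero_rpow (by exact_mod_cast hr0.ne' : (r : ℝ) ≠ 0)]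
  obtain ⟨y, rfl⟩ := FunctionSpaces.Torus.proj_surjective x
  have hg : ContinuousOn (fun s => u s (FunctionSpaces.Torus.proj y)) (Icc 0 T) := by
    have : (fun s => u s (FunctionSpaces.Torus.proj y)) = FunctionSpaces.Torus.stLift u ∘ fun s => (s, y) := rfl
    rw [this]
    exact huc.comp (continuous_id.prodMk continuous_const).continuousOn
      fun s hs => mk_mem_prod hs (mem_univ _)
  -- approximating sequences from inside `(0, T)`
  set m : ℝ := (t₁ + t₂) / 2 with hm
  have hm₁ : t₁ < m := by rw [hm]; linarith
  have hm₂ : m < t₂ := by rw [hm]; linarith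
  set a : ℕ → ℝ := fun n => t₁ + (m - t₁) / ((n : ℝ) + 1) with ha
  set b : ℕ → ℝ := fun n => t₂ - (t₂ - m) / ((n : ℝ) + 1) with hb
  have hn1 : ∀ n : ℕ, (1 : ℝ) ≤ (n : ℝ) + 1 := fun n => by
    have : (0 : ℝ) ≤ n := n.cast_nonneg
    linarith
  have ha₁ : ∀ n, t₁ < a n := fun n => by
    simp only [ha]; exact lt_add_of_pos_right _ (div_pos (sub_pos.2 hm₁) (by positivity))
  have ha₂ : ∀ n, a n ≤ m := fun n => by
    simp only [ha]
    have : (m - t₁) / ((n : ℝ) + 1) ≤ m - t₁ := div_le_self (sub_pos.2 hm₁).le (hn1 n)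
    linarith
  have hb₁ : ∀ n, m ≤ b n := fun n => by
    simp only [hb]
    have : (t₂ - m) / ((n : ℝ) + 1) ≤ t₂ - m := div_le_self (sub_pos.2 hm₂).le (hn1 n)
    linarith
  have hb₂ : ∀ n, b n < t₂ := fun n => by
    simp only [hb]; exact sub_lt_self _ (div_pos (sub_pos.2 hm₂) (by positivity))
  have hlim0 : Tendsto (fun n : ℕ => 1 / ((n : ℝ) + 1)) atTop (𝓝 0) := tendsto_one_div_add_atTop_nhds_zero_nat
  have hta : Tendsto a atTop (𝓝 t₁) := by
    have : Tendsto (fun n : ℕ => t₁ + (m - t₁) * (1 / ((n : ℝ) + 1))) atTop (𝓝 (t₁ + (m - t₁) * 0)) :=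
      tendsto_const_nhds.add (tendsto_const_nhds.mul hlim0)
    rw [mul_zero, add_zero] at this
    refine this.congr fun n => ?_
    simp only [ha]; ring
  have htb : Tendsto b atTop (𝓝 t₂) := by
    have : Tendsto (fun n : ℕ => t₂ - (t₂ - m) * (1 / ((n : ℝ) + 1))) atTop (𝓝 (t₂ - (t₂ - m) * 0)) :=
      tendsto_const_nhds.sub (tendsto_const_nhds.mul hlim0)
    rw [mul_zero, sub_zero] at this
    refine this.congr fun n => ?_
    simp only [hb]; ring
  have haI : ∀ n, a n ∈ Icc 0 T := fun n => ⟨ht₁.1.trans (ha₁ n).le, ((ha₂ n).trans hm₂.le).trans ht₂.2⟩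
  have hbI : ∀ n, b n ∈ Icc 0 T := fun n => ⟨(ht₁.1.trans hm₁.le).trans (hb₁ n), (hb₂ n).le.trans ht₂.2⟩
  -- the bound along the sequences
  have hbound : ∀ n, ‖u (b n) (FunctionSpaces.Torus.proj y) - u (a n) (FunctionSpaces.Torus.proj y)‖ ≤
      K * (b n - a n) ^ (r : ℝ) := fun n =>
    hK _ _ (ht₁.1.trans_lt (ha₁ n)) ((ha₂ n).trans (hb₁ n)) ((hb₂ n).trans_le ht₂.2) _
  -- pass to the limit
  have hL : Tendsto (fun n => ‖u (b n) (FunctionSpaces.Torus.proj y) - u (a n) (FunctionSpaces.Torus.proj y)‖)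
      atTop (𝓝 ‖u t₂ (FunctionSpaces.Torus.proj y) - u t₁ (FunctionSpaces.Torus.proj y)‖) := by
    have h2 : Tendsto (fun n => u (b n) (FunctionSpaces.Torus.proj y)) atTop
        (𝓝 (u t₂ (FunctionSpaces.Torus.proj y))) :=
      ((hg t₂ ht₂).tendsto.comp (tendsto_nhdsWithin_iff.2 ⟨htb, Eventually.of_forall hbI⟩))
    have h1 : Tendsto (fun n => u (a n) (FunctionSpaces.Torus.proj y)) atTop
        (𝓝 (u t₁ (FunctionSpaces.Torus.proj y))) :=
      ((hg t₁ ht₁).tendsto.comp (tendsto_nhdsWithin_iff.2 ⟨hta, Eventually.of_forall haI⟩))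
    exact (h2.sub h1).norm
  have hRlim : Tendsto (fun n => K * (b n - a n) ^ (r : ℝ)) atTop (𝓝 (K * (t₂ - t₁) ^ (r : ℝ))) :=
    ((htb.sub hta).rpow_const (Or.inr r.2)).const_mul _
  exact le_of_tendsto_of_tendsto' hL hRlim hbound

/-- Pointwise limits of `r`-Hölder functions with a common constant are `r`-Hölder with that
constant. [folklore] -/
theorem holderWith_of_unifLimit {X Y : Type*} [PseudoMetricSpace X] [NormedAddCommGroup Y]
    {f : ℕ → X → Y} {g : X → Y} {C r : ℝ≥0} (hf : ∀ q, HolderWith C r (f q))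
    (hlim : ∀ x, Tendsto (fun q => f q x) atTop (𝓝 (g x))) : HolderWith C r g := by
  intro x y
  have hd : Tendsto (fun q => dist (f q x) (f q y)) atTop (𝓝 (dist (g x) (g y))) :=
    (hlim x).dist (hlim y)
  have hle : dist (g x) (g y) ≤ C * dist x y ^ (r : ℝ) :=
    le_of_tendsto' hd fun q => (hf q).dist_le x y
  rw [edist_dist, edist_dist, ENNReal.ofReal_rpow_of_nonneg dist_nonneg r.coe_nonneg,
    ← ENNReal.ofReal_coe_nnreal, ← ENNReal.ofReal_mul C.coe_nonneg]
  exact ENNReal.ofReal_le_ofReal hle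

/-- A real `dist`-form Hölder bound on a set gives `HolderOnWith`. [folklore] -/
theorem holderOnWith_of_dist_le {X Y : Type*} [PseudoMetricSpace X] [PseudoMetricSpace Y]
    {f : X → Y} {s : Set X} {C r : ℝ≥0}
    (h : ∀ x ∈ s, ∀ y ∈ s, dist (f x) (f y) ≤ C * dist x y ^ (r : ℝ)) : HolderOnWith C r f s := by
  intro x hx y hy
  rw [edist_dist, edist_dist, ENNReal.ofReal_rpow_of_nonneg dist_nonneg r.coe_nonneg,
    ← ENNReal.ofReal_coe_nnreal, ← ENNReal.ofReal_mul C.coe_nonneg]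
  exact ENNReal.ofReal_le_ofReal (h x hx y hy)

/-- **Discharge of `BDSV.timeRegularity`** (Buckmaster–De Lellis–Székelyhidi–Vicol 2019, §2.2,
proof of Thm. 1.1, the time-regularity step; the general theorem is Isett, arXiv:1307.0565, and
Colombo–De Rosa 2020, Thm. 1.1). The uniform limit `u` of the velocities of classical
Euler–Reynolds triples on `[0,T] × T³` with vanishing stress and uniform `C^{β'}_x` bounds is
`C^{β''}` on `[0,T] × T³` for every `β'' < β'` (indeed for `β'' = β'`).

Proof (as formalised, with the Gauss–Weierstrass kernel in place of BDSV's mollifier `ψ_ℓ`,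
`ℓ = √τ`, and the heat flow in place of Schauder estimates): for interior times,
`‖v_q(t₂) - v_q(t₁)‖₀ ≤ 2‖e^{τΔ}v_q - v_q‖₀ + |t₂-t₁| ‖e^{τΔ}∂ₜv_q‖₀`, where
`‖e^{τΔ}v - v‖₀ ≲ [v]_{β'} τ^{β'/2}` and, from `∂ₜv = div R̊ - ∇p - div(v⊗v)`,
`Δp = div div(R̊ - v⊗v)` and `e^{τΔ}∇p = -∫_τ^∞ e^{σΔ}∇Δp dσ`,
`‖e^{τΔ}∂ₜv_q‖₀ ≲ [v_q]_{β'}‖v_q‖₀ τ^{(β'-1)/2} + ‖R̊_q‖₀ τ^{-1/2}`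
(`Torus.IsEulerReynoldsOn.norm_lift_sub_lift_le`); letting `q → ∞` removes the stress, and
`τ = (t₂-t₁)²` gives `‖u(t₂) - u(t₁)‖₀ ≲ |t₂-t₁|^{β'}` (`norm_sub_le_of_unifLimit_Icc`). With the
spatial bound `[u(t)]_{β'} ≤ C` (limit of `[v_q(t)]_{β'} ≤ C`) and the product sup-metric this is
`C^{β'}` on `[0,T] × T³`, and `C^{β''}` for `β'' ≤ β'` since the set is bounded
(`HolderOnWith.of_le`). [cite: BuckmasterEtAl2018, §2.2 (proof of Thm. 1.1, time regularity)] -/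
theorem timeRegularity_holds : timeRegularity := by
  intro T hT β' hβ'0 hβ'3 v p R u hE hv hR hC β'' hβ''
  obtain ⟨C, hC⟩ := hC
  have hβ'1 : β' < 1 := hβ'3.trans (by norm_num)
  -- continuity and boundedness of the limit; uniform bound on the velocities
  have huc : ContinuousOn (FunctionSpaces.Torus.stLift u) (Icc 0 T ×ˢ univ) :=
    Torus.continuousOn_stLift_of_unifLimit (fun q => (hE q).smooth_velocity.continuousOn_stLift) hv
  obtain ⟨U, hU⟩ := FunctionSpaces.Torus.exists_norm_le_of_continuousOn_of_isCompact huc isCompact_Icc subset_rfl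
  obtain ⟨N₁, hN₁⟩ := hv 1 one_pos
  have hV : ∀ q, N₁ ≤ q → ∀ t ∈ Icc 0 T, ∀ z, ‖v q t z‖ ≤ U + 1 := fun q hq t ht z => by
    calc ‖v q t z‖ = ‖(v q t z - u t z) + u t z‖ := by rw [sub_add_cancel]
      _ ≤ ‖v q t z - u t z‖ + ‖u t z‖ := norm_add_le _ _
      _ ≤ 1 + U := add_le_add (hN₁ q hq t ht z) (hU t ht z)
      _ = U + 1 := add_comm _ _
  have hU0 : 0 ≤ U + 1 := by
    have := (norm_nonneg _).trans (hU 0 ⟨le_rfl, hT.le⟩ 0)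
    linarith
  -- spatial Hölder bound of the limit
  have hspace : ∀ t ∈ Icc 0 T, HolderWith C β' (u t) := fun t ht =>
    holderWith_of_unifLimit (fun q => hC q t ht) fun x => by
      rw [Metric.tendsto_atTop]
      intro ε hε
      obtain ⟨N, hN⟩ := hv (ε / 2) (half_pos hε)
      exact ⟨N, fun q hq => by rw [dist_eq_norm]; exact (hN q hq t ht x).trans_lt (half_lt_self hε)⟩
  -- time Hölder bound of the limit
  obtain ⟨K₀, KA, hK₀, hKA, hD⟩ := exists_norm_sub_le_of_unifLimit (Fin 3) hβ'0 hβ'1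
  set K : ℝ := 2 * K₀ * C + KA * ((U + 1) * C) with hK
  have hK0 : 0 ≤ K := by positivity
  have hKint : ∀ t₁ t₂ : ℝ, 0 < t₁ → t₁ ≤ t₂ → t₂ < T → ∀ x, ‖u t₂ x - u t₁ x‖ ≤ K * (t₂ - t₁) ^ (β' : ℝ) :=
    fun t₁ t₂ ht₁ ht₁₂ ht₂ x => hD hT hE hv hR hC hV ht₁ ht₁₂ ht₂ x
  have htime : ∀ t₁ ∈ Icc 0 T, ∀ t₂ ∈ Icc 0 T, ∀ x, ‖u t₂ x - u t₁ x‖ ≤ K * |t₂ - t₁| ^ (β' : ℝ) := by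
    intro t₁ ht₁ t₂ ht₂ x
    rcases le_total t₁ t₂ with h12 | h21
    · rw [abs_of_nonneg (sub_nonneg.2 h12)]
      exact norm_sub_le_Icc_of_Ioo huc hβ'0 hKint ht₁ ht₂ h12 x
    · rw [abs_of_nonpos (sub_nonpos.2 h21), neg_sub, norm_sub_rev]
      exact norm_sub_le_Icc_of_Ioo huc hβ'0 hKint ht₂ ht₁ h21 x
  -- space–time Hölder with exponent `β'`
  set K' : ℝ≥0 := Real.toNNReal K + C with hK'
  have hHolder : HolderOnWith K' β' (Function.uncurry u) (Icc 0 T ×ˢ univ) := by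
    refine holderOnWith_of_dist_le fun P hP Q hQ => ?_
    obtain ⟨t, x⟩ := P
    obtain ⟨s, y⟩ := Q
    have ht : t ∈ Icc 0 T := (mem_prod.1 hP).1
    have hs : s ∈ Icc 0 T := (mem_prod.1 hQ).1
    have hdt : |s - t| ≤ dist (t, x) (s, y) := by
      rw [Prod.dist_eq, abs_sub_comm, ← Real.dist_eq]; exact le_max_left _ _
    have hdx : dist x y ≤ dist (t, x) (s, y) := by rw [Prod.dist_eq]; exact le_max_right _ _
    simp only [Function.uncurry_apply_pair]
    calc dist (u t x) (u s y) ≤ dist (u t x) (u s x) + dist (u s x) (u s y) := dist_triangle _ _ _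
      _ ≤ K * |s - t| ^ (β' : ℝ) + C * dist x y ^ (β' : ℝ) := by
          refine add_le_add ?_ ((hspace s hs).dist_le x y)
          rw [dist_eq_norm, norm_sub_rev]
          exact htime t ht s hs x
      _ ≤ K * dist (t, x) (s, y) ^ (β' : ℝ) + C * dist (t, x) (s, y) ^ (β' : ℝ) := by
          gcongr
      _ = K' * dist (t, x) (s, y) ^ (β' : ℝ) := by rw [hK', NNReal.coe_add, Real.coe_toNNReal K hK0]; ring
  -- lower the exponent on the bounded set `[0,T] × T³`
  set D : ℝ≥0 := ⟨max T 1, le_max_of_le_right zero_le_one⟩ with hD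
  have hdiam : ∀ P ∈ Icc 0 T ×ˢ (univ : Set (UnitAddTorus (Fin 3))), ∀ Q ∈ Icc 0 T ×ˢ (univ : Set (UnitAddTorus (Fin 3))),
      edist P Q ≤ D := by
    rintro ⟨t, x⟩ hP ⟨s, y⟩ hQ
    have ht : t ∈ Icc 0 T := (mem_prod.1 hP).1
    have hs : s ∈ Icc 0 T := (mem_prod.1 hQ).1
    rw [edist_dist, Prod.dist_eq, ← ENNReal.ofReal_coe_nnreal]
    refine ENNReal.ofReal_le_ofReal (max_le ?_ ?_)
    · rw [Real.dist_eq]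
      exact (abs_sub_le_iff.2 ⟨by linarith [ht.2, hs.1], by linarith [hs.2, ht.1]⟩).trans (le_max_left _ _)
    · exact ((FunctionSpaces.Torus.dist_le_half x y).trans (by norm_num)).trans (le_max_right T 1)
  exact ⟨_, hHolder.of_le hdiam hβ''.le⟩

end BDSV

end Literature.Analysis.FluidPDE
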